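import Summits.QuantumFields.BalabanUV.Beta.EriceRemainderEnclosureHistoryAutonomyComparisonNonlinearLevelGaugePrep

/-!
# EriceRemainderEnclosureHistoryAutonomyComparisonNonlinearLevelGaugeBase — (E118d) THE NONLINEAR LEVEL GAUGE IN THE DEEP REGION.  Constant excess
# `B′ = B + η` over the affine memory `B u = β₀ + Σ_{k<K} L_k·u_k` (`β₀ > 0`, `L ≥ 0`, `L_0 = 0`, any profile, any size, `η ≥ 0`); base orbit `h = S y`,
# `X_m = B′(S′h_m) − B(S h_m)`, `a_m = 1∕h_m²`, `u_m = (a_{m+1} − a_m)∕a_{m+1}`.  **`base_gauge`**: at a row `n` with `u_n ≤ 1∕(5(K+1))`, configurations comparing from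
# every pin `h_m`, `m ≥ n`, and `X_m ≥ 0` for `m ≥ n+1`:  `X_{n+1}·h_{n+1}² ≤ X_n·h_n²`.  PROOF: (E118b) `row_ge` with excess modulus `0` and `e_n = e_{n+1} = η`; the
# windows crudely, `δ^{(n+1)}_{k−1} ≤ (k−1)η ≤ Kη` ((E118c) `conf_gap_le`); per age the decay `c_{n,k} − c_{n+1,k} ≤ (3∕4)β_kΔa_n h_{n+1}⁴` ((E116b) `flow_rate_decay_le`,
# increments non-increasing) and the defect `c_{n+1,k}F(n+k+1) ≤ (9∕25)β_kΔa_n h_{n+1}⁴` ((E117a) `flow_first_entry_le`, `u` non-increasing); the budget `Σ_kβ_k ≤ Δa_n`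
# ((E116b) `flow_budget_le`); `η ≤ (125∕107)X_{n+1}` ((E118c) `step_ge_eta`, `T ≤ (K−1)F ≤ 18∕125`); and `18∕25 + (111∕100)·(1∕5)·(125∕107) ≤ 1`.  This is the BASE of the
# row induction of the sequel (E118e): deep enough along every orbit `u_n ≤ 1∕(5(K+1))` and the pins are small ((E118c) `exists_base_depth`), so that the small-pin
# estimate (E49j)(1) gives `X ≥ 0` there outright.

Cell `pub-balaban`, β-function sub-cell, BINDER row D4 «RemainderConst leaves for Bałaban's split» (`HOME/BINDER-OWNERS.md`; owner lineage `b2b-balaban-beta-an4`;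
this file by co-owner #2 lineage `b2b-balaban-beta-d4-p2`, generation 98), β-FLOW TEAM duty (1), FREEZE (0) honoured (def-free; imports (E118c) `…NonlinearLevelGaugePrep`;
uses its `const_facts` ∕ `conf_gap_le` ∕ `step_ge_eta` ∕ `loads_le` ∕ `relstep_antitone`, (E118a∕b) `affine_facts` ∕ `row_ge`, (E58b) `increment_anti`, (E116b) `flow_budget_le` ∕
`flow_rate_decay_le`, (E117a) `flow_first_entry_le`, (E48a) `family_mem` ∕ `strictAnti_of_memFlow` BY NAME; nothing restated).

HONEST FRAMING (page 1, verbatim and binding).  *"Discharging BetaPertH makes Bałaban's UV stability UNCONDITIONAL — a real constructive-QFT result; it is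
NOT the continuum limit and NOT the Clay problem."*  THIS FILE DISCHARGES NOTHING OF THE KIND.  Elementary real analysis about ABSTRACT functionals on a box
]0,γ]^ℕ with displayed floors, moduli, profiles and signs — hypotheses of a census, not facts; the form, signs, ages and moments of Bałaban's (1.22) limit
functional are NOT PRINTED ([I] p. 298; GAPS G-t4-U2-1∕-2) and NOT asserted.  Row D4 class UNCHANGED (critical-path width 0; instance 0∕1; D4 DISCHARGE NO
DATE).  HONEST DEPENDENCY: continuum YM on T⁴ ⇐ BetaPertH ∧ nine spine estimates (0/9 proved); BetaPertH ⇐ (D1) ∧ (D4) ∧ CAP+tail; G-an2-4 gates asym, D1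
and NE2/3/4.  NOT CLAIMED here: the comparison theorem itself (the sequel); anything printed — NOT B12 Thm 2, NOT BetaPertH, NOT continuum, NOT Clay.

WHAT IS PROVED ([folklore]; 0 `def`, 0 sorry).  **`base_gauge`**.
-/

noncomputable section
open Finset Set

namespace Summit.QuantumFields.BalabanUV.Beta.EriceRemainderEnclosureHistoryAutonomyComparisonNonlinearLevelGaugeBase

open Literature.MathematicalPhysics.QuantumFieldTheory.Balaban1983to89
open Literature.MathematicalPhysics.QuantumFieldTheory.Balaban1983to89.T4BetaStationary
open Literature.MathematicalPhysics.QuantumFieldTheory.Balaban1983to89.T4BetaFlowWellPosed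
open Summit.QuantumFields.BalabanUV.Beta.EriceRemainderEnclosureHistoryAutonomyOrder (family_mem strictAnti_of_memFlow)
open Summit.QuantumFields.BalabanUV.Beta.EriceRemainderEnclosureHistoryAutonomyComparisonAffineProfile (increment_anti)
open Summit.QuantumFields.BalabanUV.Beta.EriceRemainderEnclosureHistoryAutonomyComparisonAgeCompositionHeatingCriterionFlow (flow_budget_le flow_rate_decay_le)
open Summit.QuantumFields.BalabanUV.Beta.EriceRemainderEnclosureHistoryAutonomyComparisonAgeCompositionDampedLevelGaugePrep (flow_first_entry_le)
open Summit.QuantumFields.BalabanUV.Beta.EriceRemainderEnclosureHistoryAutonomyComparisonNonlinearRowPrep (affine_facts)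
open Summit.QuantumFields.BalabanUV.Beta.EriceRemainderEnclosureHistoryAutonomyComparisonNonlinearRow (row_ge)
open Summit.QuantumFields.BalabanUV.Beta.EriceRemainderEnclosureHistoryAutonomyComparisonNonlinearLevelGaugePrep

variable {B B' : (ℕ → ℝ) → ℝ} {γ β₀ η : ℝ} {L : ℕ → ℝ} {K : ℕ} {S S' : ℝ → ℕ → ℝ}

/-! ## §4 The gauge in the deep region, by crude window bounds -/

set_option maxHeartbeats 800000 in
/-- **THE LEVEL GAUGE IN THE DEEP REGION.**  Constant excess over the affine memory; base orbit `h = S y`; at a row `n` with relative level step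
`u_n = (a_{n+1} − a_n)∕a_{n+1} ≤ 1∕(5(K+1))`, configurations comparing from every pin `h_m`, `m ≥ n`, and `X_m ≥ 0` for `m ≥ n+1`:  `X_{n+1}·h_{n+1}² ≤ X_n·h_n²`.
((E118b) `row_ge` with excess modulus `0`; windows `≤ K·η` (`conf_gap_le`), decay `≤ (3∕4)β_kΔa_n h_{n+1}⁴` ((E116b) `flow_rate_decay_le`), defect `≤ (9∕25)β_kΔa_n h_{n+1}⁴`
((E117a) `flow_first_entry_le`, `relstep_antitone`), budget ((E116b) `flow_budget_le`), `η ≤ (125∕107)·X_{n+1}` (`step_ge_eta`, `loads_le`), and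
`18∕25 + (111∕100)·(125∕107)∕5 ≤ 1`.) [folklore] -/
theorem base_gauge (hBaff : ∀ u, SeqBox γ u → B u = β₀ + ∑ k ∈ range K, L k * u k) (hL : ∀ k, 0 ≤ L k) (hL0 : L 0 = 0) (hβ : 0 < β₀)
    (hB'eq : ∀ u, SeqBox γ u → B' u = B u + η) (hη : 0 ≤ η)
    (hS : ∀ p, 0 < p → p ≤ γ → SeqBox γ (S p) ∧ MemFlow B p (S p))
    (huniq : ∀ p, 0 < p → p ≤ γ → ∀ u u' : ℕ → ℝ, SeqBox γ u → SeqBox γ u' → MemFlow B p u → MemFlow B p u' → u = u')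
    (hS' : ∀ p, 0 < p → p ≤ γ → SeqBox γ (S' p) ∧ MemFlow B' p (S' p))
    (huniq' : ∀ p, 0 < p → p ≤ γ → ∀ u u' : ℕ → ℝ, SeqBox γ u → SeqBox γ u' → MemFlow B' p u → MemFlow B' p u' → u = u')
    {y : ℝ} (hy : 0 < y) (hyγ : y ≤ γ) (n : ℕ)
    (hu : (1 / S y (n + 1) ^ 2 - 1 / S y n ^ 2) * S y (n + 1) ^ 2 ≤ 1 / (5 * ((K : ℝ) + 1)))
    (hcmp : ∀ m, n ≤ m → ∀ j, S' (S y m) j ≤ S y (m + j)) (hX : ∀ m, n + 1 ≤ m → 0 ≤ B' (S' (S y m)) - B (S (S y m))) :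
    (B' (S' (S y (n + 1))) - B (S (S y (n + 1)))) * S y (n + 1) ^ 2 ≤ (B' (S' (S y n)) - B (S (S y n))) * S y n ^ 2 := by
  obtain ⟨hmono', hlo', hB', _, _, hEmod⟩ := const_facts hBaff hL hβ hB'eq hη
  obtain ⟨hmono, hlo, hdom, _⟩ := affine_facts hBaff hL hβ
  have hM' : 0 ≤ ∑ k ∈ range K, L k := sum_nonneg fun k _ => hL k
  have hh := (hS y hy hyγ).1
  have hf := (hS y hy hyγ).2
  have hpos : ∀ j, 0 < S y j := fun j => (hh j).1
  have hanti := (strictAnti_of_memFlow hβ hlo hh hf).antitone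
  -- abbreviations
  set X1 : ℝ := B' (S' (S y (n + 1))) - B (S (S y (n + 1))) with hX1def
  set Da : ℝ := 1 / S y (n + 1) ^ 2 - 1 / S y n ^ 2 with hDa
  set un : ℝ := Da * S y (n + 1) ^ 2 with hun
  have hX10 : 0 ≤ X1 := hX (n + 1) le_rfl
  have hDa0 : 0 ≤ Da := by simp only [hDa]; rw [hf.2 n]; linarith [hlo _ (seqBox_shift hh (n + 1))]
  have hun0 : 0 ≤ un := mul_nonneg hDa0 (sq_nonneg _)
  have hK1 : (0 : ℝ) < 5 * ((K : ℝ) + 1) := by positivity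
  have hKu : (K : ℝ) * un ≤ 1 / 5 := by
    have hK0 : (0 : ℝ) ≤ (K : ℝ) := Nat.cast_nonneg K
    have h1 : (K : ℝ) * un ≤ (K : ℝ) * (1 / (5 * ((K : ℝ) + 1))) := mul_le_mul_of_nonneg_left hu hK0
    have h2 : (K : ℝ) * (1 / (5 * ((K : ℝ) + 1))) ≤ 1 / 5 := by
      rw [mul_one_div, div_le_div_iff₀ hK1 (by norm_num : (0:ℝ) < 5)]; nlinarith
    exact h1.trans h2
  -- the excess is the constant η at every configuration's pin
  have he : ∀ m, B' (S' (S y m)) - B (S' (S y m)) = η := fun m => by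
    have hq := family_mem hS hy hyγ m; rw [hB'eq _ (hS' _ hq.1 hq.2).1]; ring
  -- the row inequality with excess modulus 0
  have hrow := row_ge hBaff hL hL0 hβ hmono' hβ hB' hM' hlo' hEmod le_rfl hS huniq hS' huniq' hy hyγ n hcmp hX
  rw [he n, he (n + 1), sub_self, zero_add] at hrow
  -- first entries: F(n) ≤ (18/25) u_n
  have hF := flow_first_entry_le hmono hL hβ hlo hdom hh hf n
  -- u is non-increasing: u_t ≤ u_n for t ≥ n
  have hurel : ∀ t, n ≤ t → (1 / S y (t + 1) ^ 2 - 1 / S y t ^ 2) * S y (t + 1) ^ 2 ≤ un := fun t ht =>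
    relstep_antitone hmono hβ hlo hh hf ht
  -- η ≤ (125/107) X1
  have hT := step_ge_eta hBaff hL hβ hB'eq hη hS huniq hS' huniq' hy hyγ (n + 1) (fun m' hm' => hcmp m' (by omega))
  have hloads := loads_le (K := K) hL hpos (n + 1)
  have hF1 := flow_first_entry_le hmono hL hβ hlo hdom hh hf (n + 1)
  have hu1 := hurel (n + 1) (by omega)
  have hTle : ∑ k ∈ Ico 1 K, (k : ℝ) * (L k * S y (n + 1 + k) ^ 3 / 2) ≤ 18 / 125 := by
    have hF1' : ∑ k ∈ Ico 1 K, L k * S y (n + 1 + k) ^ 3 / 2 ≤ 18 / 25 * un := by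
      refine hF1.trans ?_
      have := mul_le_mul_of_nonneg_left hu1 (by norm_num : (0:ℝ) ≤ 18 / 25)
      linarith
    have hF10 : 0 ≤ ∑ k ∈ Ico 1 K, L k * S y (n + 1 + k) ^ 3 / 2 :=
      sum_nonneg fun k _ => by have := hL k; have := hpos (n + 1 + k); positivity
    have hK0 : (0 : ℝ) ≤ K := Nat.cast_nonneg K
    calc ∑ k ∈ Ico 1 K, (k : ℝ) * (L k * S y (n + 1 + k) ^ 3 / 2) ≤ ((K : ℝ) - 1) * ∑ k ∈ Ico 1 K, L k * S y (n + 1 + k) ^ 3 / 2 := hloads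
      _ ≤ (K : ℝ) * (18 / 25 * un) := by nlinarith
      _ = 18 / 25 * ((K : ℝ) * un) := by ring
      _ ≤ 18 / 125 := by nlinarith
  have hηX : η ≤ 125 / 107 * X1 := by
    have h1 : η * (1 - 18 / 125) ≤ η * (1 - ∑ k ∈ Ico 1 K, (k : ℝ) * (L k * S y (n + 1 + k) ^ 3 / 2)) :=
      mul_le_mul_of_nonneg_left (by linarith) hη
    have : η * (1 - 18 / 125) ≤ X1 := h1.trans hT
    nlinarith
  -- per-age coefficient: decay + defect ≤ (111/100) β_k Da h(n+1)⁴
  have hcoef : ∀ k ∈ Finset.Ico 1 K,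
      L k * S y (n + k) ^ 3 / 2 - L k * S y (n + 1 + k) ^ 3 / 2
        + L k * S y (n + 1 + k) ^ 3 / 2 * (∑ q ∈ Ico 1 K, L q * S y (n + k + 1 + q) ^ 3 / 2 + 0 * S y (n + k + 1) ^ 3 / 2)
      ≤ 111 / 100 * (L k * S y (n + 1 + k)) * Da * S y (n + 1) ^ 4 := by
    intro k hk
    have hk1 : 1 ≤ k := (Finset.mem_Ico.mp hk).1
    have hβk : 0 ≤ L k * S y (n + 1 + k) := mul_nonneg (hL k) (hpos _).le
    -- decay
    have hdec := flow_rate_decay_le hL hβ hlo hh hf k n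
    have hDk : 1 / S y (n + 1 + k) ^ 2 - 1 / S y (n + k) ^ 2 ≤ Da := by
      simp only [hDa]; rw [show n + 1 + k = (n + k) + 1 by ring, hf.2 (n + k), hf.2 n]
      have := increment_anti hmono hβ hlo hh hf (show n ≤ n + k by omega); linarith
    have h4 : S y (n + k) ^ 4 ≤ S y (n + 1) ^ 4 := pow_le_pow_left₀ (hpos _).le (hanti (by omega)) 4
    have hdec' : L k * S y (n + k) ^ 3 / 2 - L k * S y (n + 1 + k) ^ 3 / 2 ≤ 3 / 4 * (L k * S y (n + 1 + k)) * Da * S y (n + 1) ^ 4 := by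
      refine hdec.trans ?_
      have := mul_le_mul (mul_le_mul_of_nonneg_left hDk (by positivity : (0:ℝ) ≤ 3 / 4 * (L k * S y (n + 1 + k)))) h4
        (by have := hpos (n + k); positivity) (by positivity)
      linarith
    -- defect
    have hFk := flow_first_entry_le hmono hL hβ hlo hdom hh hf (n + k + 1)
    have huk := hurel (n + k + 1) (by omega)
    have hFk' : ∑ q ∈ Ico 1 K, L q * S y (n + k + 1 + q) ^ 3 / 2 ≤ 18 / 25 * un := by
      refine hFk.trans ?_
      have := mul_le_mul_of_nonneg_left huk (by norm_num : (0:ℝ) ≤ 18 / 25)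
      linarith
    have hc1 : L k * S y (n + 1 + k) ^ 3 / 2 ≤ (L k * S y (n + 1 + k)) * S y (n + 1) ^ 2 / 2 := by
      have h2 : S y (n + 1 + k) ^ 2 ≤ S y (n + 1) ^ 2 := pow_le_pow_left₀ (hpos _).le (hanti (by omega)) 2
      have := mul_le_mul_of_nonneg_left h2 hβk
      nlinarith
    have hdef : L k * S y (n + 1 + k) ^ 3 / 2 * (∑ q ∈ Ico 1 K, L q * S y (n + k + 1 + q) ^ 3 / 2 + 0 * S y (n + k + 1) ^ 3 / 2)
        ≤ 9 / 25 * (L k * S y (n + 1 + k)) * Da * S y (n + 1) ^ 4 := by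
      rw [zero_mul, zero_div, add_zero]
      have hF0 : 0 ≤ ∑ q ∈ Ico 1 K, L q * S y (n + k + 1 + q) ^ 3 / 2 :=
        sum_nonneg fun q _ => by have := hL q; have := hpos (n + k + 1 + q); positivity
      calc L k * S y (n + 1 + k) ^ 3 / 2 * (∑ q ∈ Ico 1 K, L q * S y (n + k + 1 + q) ^ 3 / 2)
          ≤ ((L k * S y (n + 1 + k)) * S y (n + 1) ^ 2 / 2) * (18 / 25 * un) :=
            mul_le_mul hc1 hFk' hF0 (by have := hpos (n + 1); positivity)
        _ = 9 / 25 * (L k * S y (n + 1 + k)) * Da * S y (n + 1) ^ 4 := by simp only [hun]; ring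
    linarith
  -- windows ≤ K η, and the sum of the heating/defect terms
  have hwin : ∀ k ∈ Finset.Ico 1 K, 0 ≤ 1 / S' (S y (n + 1)) (k - 1) ^ 2 - 1 / S y (n + k) ^ 2
      ∧ 1 / S' (S y (n + 1)) (k - 1) ^ 2 - 1 / S y (n + k) ^ 2 ≤ (K : ℝ) * η := by
    intro k hk
    obtain ⟨j, rfl⟩ : ∃ j, k = j + 1 := ⟨k - 1, by have := (Finset.mem_Ico.mp hk).1; omega⟩
    simp only [Nat.add_sub_cancel]
    have hgap := conf_gap_le hBaff hL hβ hB'eq hη hS huniq hS' huniq' hy hyγ (n + 1) (fun m' hm' => hcmp m' (by omega)) j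
    rw [show n + 1 + j = n + (j + 1) by ring] at hgap
    have hjK : (j : ℝ) ≤ K := by have := (Finset.mem_Ico.mp hk).2; exact_mod_cast (by omega : j ≤ K)
    have hc := hcmp (n + 1) (by omega) j
    rw [show n + 1 + j = n + (j + 1) by ring] at hc
    have hq1 := family_mem hS hy hyγ (n + 1)
    have hwp := ((hS' _ hq1.1 hq1.2).1 j).1
    exact ⟨sub_nonneg.mpr (one_div_le_one_div_of_le (pow_pos hwp 2) (pow_le_pow_left₀ hwp.le hc 2)),
      hgap.trans (mul_le_mul_of_nonneg_right hjK hη)⟩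
  have hsum : ∑ k ∈ Ico 1 K, (L k * S y (n + k) ^ 3 / 2 - L k * S y (n + 1 + k) ^ 3 / 2
        + L k * S y (n + 1 + k) ^ 3 / 2 * (∑ q ∈ Ico 1 K, L q * S y (n + k + 1 + q) ^ 3 / 2 + 0 * S y (n + k + 1) ^ 3 / 2))
        * (1 / S' (S y (n + 1)) (k - 1) ^ 2 - 1 / S y (n + k) ^ 2)
      ≤ ∑ k ∈ Ico 1 K, 111 / 100 * (L k * S y (n + 1 + k)) * Da * S y (n + 1) ^ 4 * ((K : ℝ) * η) := by
    refine sum_le_sum fun k hk => ?_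
    obtain ⟨hw0, hwK⟩ := hwin k hk
    have hβk : 0 ≤ 111 / 100 * (L k * S y (n + 1 + k)) * Da * S y (n + 1) ^ 4 := by
      have := hL k; have := hpos (n + 1 + k); have := hpos (n + 1); positivity
    exact mul_le_mul (hcoef k hk) hwK hw0 hβk
  rw [← sum_mul, ← sum_mul, ← sum_mul] at hsum
  have hbud : ∑ k ∈ Ico 1 K, 111 / 100 * (L k * S y (n + 1 + k)) ≤ 111 / 100 * Da := by
    rw [← mul_sum]
    refine mul_le_mul_of_nonneg_left ?_ (by norm_num)
    have hb' := flow_budget_le hdom hh hf n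
    calc ∑ k ∈ Ico 1 K, L k * S y (n + 1 + k) ≤ ∑ k ∈ range K, L k * S y (n + 1 + k) :=
          sum_le_sum_of_subset_of_nonneg (fun k hk => mem_range.mpr (Finset.mem_Ico.mp hk).2) fun k _ _ => mul_nonneg (hL k) (hpos _).le
      _ ≤ Da := hb'
  -- assemble: X n ≥ X1 − (18/25) un X1 − (111/100) Da² h⁴ K η ≥ X1 (1 − un)
  have h1sq : 0 < S y (n + 1) ^ 2 := pow_pos (hpos _) 2
  have hn2 : 0 < S y n ^ 2 := pow_pos (hpos _) 2
  have hmain : X1 * (1 - un) ≤ B' (S' (S y n)) - B (S (S y n)) := by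
    have hA : (∑ k ∈ Ico 1 K, L k * S y (n + k) ^ 3 / 2) * X1 ≤ 18 / 25 * un * X1 := by
      have := mul_le_mul_of_nonneg_right hF hX10; simp only [hun, hDa]; linarith
    have hB : (∑ k ∈ Ico 1 K, 111 / 100 * (L k * S y (n + 1 + k))) * Da * S y (n + 1) ^ 4 * ((K : ℝ) * η)
        ≤ 111 / 100 * Da * Da * S y (n + 1) ^ 4 * ((K : ℝ) * η) := by
      have : 0 ≤ Da * S y (n + 1) ^ 4 * ((K : ℝ) * η) := by positivity
      calc (∑ k ∈ Ico 1 K, 111 / 100 * (L k * S y (n + 1 + k))) * Da * S y (n + 1) ^ 4 * ((K : ℝ) * η)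
          = (∑ k ∈ Ico 1 K, 111 / 100 * (L k * S y (n + 1 + k))) * (Da * S y (n + 1) ^ 4 * ((K : ℝ) * η)) := by ring
        _ ≤ (111 / 100 * Da) * (Da * S y (n + 1) ^ 4 * ((K : ℝ) * η)) := mul_le_mul_of_nonneg_right hbud this
        _ = 111 / 100 * Da * Da * S y (n + 1) ^ 4 * ((K : ℝ) * η) := by ring
    have hC : 111 / 100 * Da * Da * S y (n + 1) ^ 4 * ((K : ℝ) * η) = 111 / 100 * un * ((K : ℝ) * un) * η := by simp only [hun]; ring
    have hD : 111 / 100 * un * ((K : ℝ) * un) * η ≤ 111 / 100 * un * (1 / 5) * (125 / 107 * X1) :=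
      mul_le_mul (mul_le_mul_of_nonneg_left hKu (by positivity)) hηX hη (by positivity)
    have hnum : 18 / 25 * un * X1 + 111 / 100 * un * (1 / 5) * (125 / 107 * X1) ≤ un * X1 := by nlinarith [mul_nonneg hun0 hX10]
    nlinarith [hrow, hsum, hA, hB, hC, hD, hnum]
  -- 1 − un = h(n+1)²/h(n)²
  have e : 1 - un = S y (n + 1) ^ 2 * (1 / S y n ^ 2) := by
    simp only [hun, hDa]; rw [sub_mul, one_div_mul_cancel h1sq.ne']; ring
  rw [e] at hmain
  have := mul_le_mul_of_nonneg_right hmain hn2.le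
  have e2 : X1 * (S y (n + 1) ^ 2 * (1 / S y n ^ 2)) * S y n ^ 2 = X1 * S y (n + 1) ^ 2 := by
    rw [mul_assoc, mul_assoc, one_div_mul_cancel hn2.ne', mul_one]
  rw [e2] at this
  linarith

end Summit.QuantumFields.BalabanUV.Beta.EriceRemainderEnclosureHistoryAutonomyComparisonNonlinearLevelGaugeBase

end
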